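import Summits.SmoothPoincare4.SmoothPoincare4.Theorems.SymplecticOrigamiGromovRecognitionRelEndGlueData
import Summits.SmoothPoincare4.SmoothPoincare4.Theorems.SymplecticOrigamiGromovRecognitionRelEndClassCount
import Summits.SmoothPoincare4.SmoothPoincare4.Theorems.SymplecticOrigamiGromovRecognitionRelEndMoebiusHomotopic
import Summits.SmoothPoincare4.SmoothPoincare4.Theorems.SymplecticOrigamiGromovRecognitionRelEndGluedBasics
import Summits.SmoothPoincare4.SmoothPoincare4.Theorems.SymplecticOrigamiGromovRecognitionRelEndCountOneStructure
import Summits.SmoothPoincare4.SmoothPoincare4.Theorems.SymplecticOrigamiGromovRecognitionRelEndHolCoordCompJHol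
import Literature.Geometry.Symplectic.AdjunctionEmbeddedSpheres
import Literature.Geometry.Symplectic.JCurveIntersectionCountHomological
import Literature.Geometry.Symplectic.PlusOneSpherePairProofs
import Literature.Geometry.Symplectic.JHolomorphicLocalIntersectionsProofs
import Literature.Geometry.Manifold.HomotopyClassesOpen
import Mathlib.Topology.Metrizable.Urysohn
import Mathlib.Topology.Sequences

/-!
# Case (A) of Gromov compactness for leaves gives a leaf through the limit point
(registered helper `helper_caseA_leaf` of line `cross-cap-laurent`, crux `GromovRecognitionRelEnd`,
item stmt-SmoothPoincare4-11009; integration lemma L6a of the glue of the bi-foliation)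

Setting: the data `FoliationData ωX JX u₀ v₀ uH vH F₀ TH TV UH UV δ` of one foliation of the wedge
cap (`…GlueData`), the facts `jSphere_wedgeCount_factorsThroughHomology` (F6) and
`adjunction_embedded_of_somewhereInjective_sphere` (F4) as hypotheses, and the output of case (A)
of Gromov compactness applied to a sequence of glued maps `Fs n ~ F₀` with points
`ys n ∈ range (Fs n)`, `ys n → y`: reparametrised maps `(Fs (φ k)) ∘ [A k] → F` in `C(ℂℙ¹, X)`,
`A k ∈ GL₂(ℂ)`, with `F` the glued map of a `JX`-two-chart sphere `(u, v)`.

Claim (`helper_caseA_leaf`): there is a LEAF of the family of `F₀` through `y`.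

Proof.
1. `F ~ F₀`: `[A k] ~ id` (`helper_moebiusHomotopic`), so `(Fs (φ k)) ∘ [A k] ~ Fs (φ k) ~ F₀`, and
   homotopy classes in `C(ℂℙ¹, X)` are closed under limits (`ContinuousMap.Homotopic.of_tendsto`,
   `X` a compact manifold without boundary).
2. `y ∈ range F`: write `ys (φ k) = ((Fs (φ k)) ∘ [A k]) (p k)` (`[A k]` is onto), extract a
   convergent subsequence `p (ψ j) → p₀` (`ℂℙ¹` is compact metrisable), and use joint continuity
   of evaluation (`ℂℙ¹` locally compact): the values tend to `F p₀` and to `y`, so `F p₀ = y`.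
3. `range F = pairImage u v` (`helper_gluedRange`).
4. `(u, v)` meets `S_H = {TH = 0} ∩ UH` with count one and is not inside it (`helper_class_count`
   at `t = 0`), hence (`helper_countOneStructure`) EITHER at a unique parameter `z₀` of the affine
   chart, simply (`deriv (TH ∘ u) z₀ ≠ 0`) and not at `v 0`, OR nowhere in the affine chart and
   simply at `v 0`.
5. Somewhere injectivity + adjunction (F4, with the reference sphere `(u₀, v₀)`, its witness
   `(UV, TV)` — submersive by `helper_holCoordinate_surjective` — and glued map `F₀`): in the
   first case `du (z₀)` is injective (a simple zero of `TH ∘ u` forces `du (z₀) ≠ 0` by the chain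
   rule, and `du` is injective or zero, `IsJHolomorphic.injective_mfderiv_iff_ne_zero`), `u z₀`
   has the single preimage `z₀` and `v 0 ≠ u z₀`, so `(u, v)` is embedded with a normal witness:
   a leaf containing `y`.  In the second case swap the charts (`helper_swapGlued`: `F ∘ σ` is
   glued to `(v, u)`, `σ ~ id`): `(v, u)` is somewhere injective at `0` by the same reasoning,
   hence a leaf, and `pairImage u v ⊆ pairImage v u`.

References: M. Gromov, Invent. Math. 82 (1985), §2.4; D. McDuff, J. Amer. Math. Soc. 3 (1990),
Lemma 3.1, §3; C. Wendl, *Holomorphic Curves in Low Dimensions* (2018), Cor. 2.52 (adjunction);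
J. M. Lee, *Introduction to Smooth Manifolds*, 2nd ed. (2013), Prop. 6.25 (nearby maps are
homotopic).  No new definitions, notation or instances.
-/

noncomputable section

open scoped Manifold ContDiff Topology
open Set Function Filter Literature.Topology.FourManifolds Literature.Topology.FourManifolds.ComplexProjectiveSpace
  Literature.Geometry.Kaehler Literature.Geometry.Symplectic Literature.AlgebraicTopology.SingularHomology

-- the prescribed namespace `Summit.<P>.<Sub>.…` duplicates `SmoothPoincare4` (P = Sub)
set_option linter.dupNamespace false

namespace Summit.SmoothPoincare4.SmoothPoincare4.Theorems.GromovRecognitionRelEnd.CrossCapLaurent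

namespace CaseALeaf

/-! ### Limits of points on converging maps -/

/-- **Limits of points on the images of converging maps lie on the image of the limit.**  If
`G k → F` in `C(K, Y)` with `K` sequentially compact and locally compact and `Y` Hausdorff, and
`ys k ∈ range (G k)` converge to `y`, then `y ∈ range F`: write `ys k = G k (p k)`, extract a
convergent subsequence `p (ψ j) → p₀`, and evaluate (evaluation `C(K, Y) × K → Y` is jointly
continuous): `ys (ψ j) → F p₀`, so `F p₀ = y`. -/
theorem mem_range_of_tendsto {K Y : Type*} [TopologicalSpace K] [SeqCompactSpace K]
    [LocallyCompactSpace K] [TopologicalSpace Y] [T2Space Y] {G : ℕ → C(K, Y)} {F : C(K, Y)}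
    (hG : Tendsto G atTop (𝓝 F)) {ys : ℕ → Y} {y : Y} (hys : ∀ k, ys k ∈ range (G k))
    (hy : Tendsto ys atTop (𝓝 y)) : y ∈ range F := by
  choose p hp using hys
  obtain ⟨p₀, ψ, hψ, hpψ⟩ := SeqCompactSpace.tendsto_subseq p
  have h1 : Tendsto (fun j => G (ψ j) (p (ψ j))) atTop (𝓝 (F p₀)) :=
    (hG.comp hψ.tendsto_atTop).eval hpψ
  have h2 : Tendsto (fun j => G (ψ j) (p (ψ j))) atTop (𝓝 y) := by
    simp only [hp]
    exact hy.comp hψ.tendsto_atTop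
  exact ⟨p₀, tendsto_nhds_unique h1 h2⟩

/-! ### A simple zero of `T ∘ u` forces `du ≠ 0` -/

/-- **A simple meeting point is an immersed point.**  For a holomorphic coordinate `T` on `U`
and a smooth `J`-holomorphic `u : ℂ → X` with `u z₀ ∈ U`: if `deriv (T ∘ u) z₀ ≠ 0` then
`du (z₀)` is injective.  Indeed `du (z₀)` is injective or zero
(`IsJHolomorphic.injective_mfderiv_iff_ne_zero`), and if it were zero the chain rule would give
`d(T ∘ u)(z₀) = dT ∘ du (z₀) = 0`, whereas `T ∘ u` is complex differentiable at `z₀`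
(`helper_holCoordCompJHol`) with derivative `deriv (T ∘ u) z₀ ≠ 0`. -/
theorem injective_mfderiv_of_deriv_comp_ne_zero {X : Type} [TopologicalSpace X]
    [ChartedSpace (EuclideanSpace ℝ (Fin 4)) X] [IsManifold (𝓡 4) ∞ X]
    {JX : ∀ y : X, TangentSpace (𝓡 4) y →L[ℝ] TangentSpace (𝓡 4) y} {T : X → ℂ} {U : Set X}
    (hT : IsHolCoordinate JX T U) {u : ℂ → X} (hu : ContMDiff 𝓘(ℝ, ℂ) (𝓡 4) ∞ u)
    (hJu : IsJHolomorphic (𝓡 4) JX u) {z₀ : ℂ} (hz₀ : u z₀ ∈ U) (hd : deriv (T ∘ u) z₀ ≠ 0) :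
    Injective (mfderiv 𝓘(ℝ, ℂ) (𝓡 4) u z₀) := by
  refine (hJu.injective_mfderiv_iff_ne_zero z₀).mpr fun h0 => hd ?_
  -- `T ∘ u` is complex differentiable at `z₀`
  have hdiff : DifferentiableAt ℂ (T ∘ u) z₀ :=
    (helper_holCoordCompJHol X JX T U u hT.isOpen hT.smooth hT.hol hu hJu).differentiableAt
      ((hT.isOpen.preimage hu.continuous).mem_nhds hz₀)
  -- its real differential is `dT ∘ du (z₀) = 0`
  have hTz : MDifferentiableAt (𝓡 4) 𝓘(ℝ, ℂ) T (u z₀) :=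
    (hT.smooth.contMDiffAt (hT.isOpen.mem_nhds hz₀)).mdifferentiableAt (by simp)
  have huz : MDifferentiableAt 𝓘(ℝ, ℂ) (𝓡 4) u z₀ := hu.mdifferentiableAt (by simp)
  have hF : HasFDerivAt (T ∘ u)
      ((mfderiv (𝓡 4) 𝓘(ℝ, ℂ) T (u z₀)).comp (mfderiv 𝓘(ℝ, ℂ) (𝓡 4) u z₀) : ℂ →L[ℝ] ℂ) z₀ :=
    (hTz.hasMFDerivAt.comp z₀ huz.hasMFDerivAt).hasFDerivAt
  -- compare with the complex derivative
  have hF' : HasFDerivAt (T ∘ u)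
      ((ContinuousLinearMap.smulRight (1 : ℂ →L[ℂ] ℂ) (deriv (T ∘ u) z₀)).restrictScalars ℝ) z₀ :=
    hdiff.hasDerivAt.hasFDerivAt.restrictScalars ℝ
  have h : _ = mfderiv (𝓡 4) 𝓘(ℝ, ℂ) T (u z₀) (mfderiv 𝓘(ℝ, ℂ) (𝓡 4) u z₀ (1 : ℂ)) :=
    DFunLike.congr_fun (hF'.unique hF) 1
  rw [h0] at h
  simp only [ContinuousLinearMap.coe_restrictScalars', ContinuousLinearMap.smulRight_apply,
    one_apply_eq_self, one_smul, _root_.zero_apply, map_zero] at h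
  exact h

/-! ### The adjunction step and the chart swap -/

section Adjunction

variable {X : Type} [TopologicalSpace X] [T2Space X] [SecondCountableTopology X]
  [ChartedSpace (EuclideanSpace ℝ (Fin 4)) X] [IsManifold (𝓡 4) ∞ X]

/-- **Somewhere injective spheres in the class of the reference sphere are leaves.**  Given the
foliation data and the adjunction fact (hypothesis), a `JX`-two-chart sphere `(u, v)` with glued
map `F ~ F₀` which is somewhere injective (a parameter `z₀` with `du (z₀)` injective, `u z₀` having
the single preimage `z₀`, and `v 0 ≠ u z₀`) is embedded with a trivial-normal-bundle witness, i.e.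
a leaf: the fact is applied with the embedded reference sphere `(u₀, v₀)`, its witness `(UV, TV)`
(`coordV`, submersive by `helper_holCoordinate_surjective`, zero set `zeroSetV`) and `F₀`. -/
theorem isLeafOf_of_somewhereInjective {ωX : MForm (𝓡 4) X ℝ 2}
    {JX : AlmostComplexStructure (𝓡 4) ∞ X} {u₀ v₀ uH vH : ℂ → X}
    {F₀ : C(ComplexProjectiveSpace 1, X)} {TH TV : X → ℂ} {UH UV : Set X} {δ : ℝ}
    (hadj : adjunction_embedded_of_somewhereInjective_sphere)
    (D : FoliationData ωX JX u₀ v₀ uH vH F₀ TH TV UH UV δ) {u v : ℂ → X}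
    {F : C(ComplexProjectiveSpace 1, X)} (huv : TwoChartSphere (fun y => JX y) u v)
    (hF : IsGlued F u v) (hhom : F.Homotopic F₀)
    (hsi : ∃ z₀ : ℂ, Injective (mfderiv 𝓘(ℝ, ℂ) (𝓡 4) u z₀) ∧ (∀ z, u z = u z₀ → z = z₀) ∧
      v 0 ≠ u z₀) :
    IsLeafOf (fun y => JX y) F₀ u v := by
  -- the reference witness `(UV, TV)`
  have hzero : {y | y ∈ UV ∧ TV y = 0} = range u₀ ∪ {v₀ 0} :=
    D.zeroSetV.trans (pairImage_eq u₀ v₀)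
  have hsub : range u₀ ∪ {v₀ 0} ⊆ UV := fun y hy => by
    rw [← hzero] at hy
    exact hy.1
  obtain ⟨hemb, N', π', hN', hsub', hπ', hsubm', hzero'⟩ := hadj X JX u₀ v₀ UV TV u v F F₀
    D.ref_sphere.smooth_u D.ref_sphere.smooth_v D.ref_sphere.compat D.ref_sphere.hol_u
    D.ref_sphere.hol_v D.ref_embedded.injective D.ref_embedded.imm_u D.ref_embedded.imm_v
    D.ref_embedded.infty_notMem D.coordV.isOpen hsub D.coordV.smooth
    (helper_holCoordinate_surjective X (fun y => JX y) TV UV D.coordV) hzero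
    huv.smooth_u huv.smooth_v huv.compat huv.hol_u huv.hol_v hF.chart_zero hF.chart_one
    D.ref_glued.chart_zero D.ref_glued.chart_one hhom hsi
  exact ⟨huv, (isEmbeddedPair_iff u v).mpr hemb,
    ⟨N', π', (isNormalWitness_iff N' π' u v).mpr ⟨hN', hsub', hπ', hsubm', hzero'⟩⟩, ⟨F, hF, hhom⟩⟩

omit [T2Space X] [SecondCountableTopology X] [IsManifold (𝓡 4) ∞ X] in
/-- **The chart swap of a two-chart sphere is a two-chart sphere** (compatibility
`u z = v z⁻¹` for `z ≠ 0` from `v z⁻¹ = u z⁻¹⁻¹`). -/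
theorem twoChartSphere_swap {JX : ∀ y : X, TangentSpace (𝓡 4) y →L[ℝ] TangentSpace (𝓡 4) y}
    {u v : ℂ → X} (huv : TwoChartSphere JX u v) : TwoChartSphere JX v u :=
  { smooth_u := huv.smooth_v
    smooth_v := huv.smooth_u
    compat := fun z hz => by rw [huv.compat z⁻¹ (inv_ne_zero hz), inv_inv]
    hol_u := huv.hol_v
    hol_v := huv.hol_u }

end Adjunction

/-- **The image of a two-chart pair is contained in the image of the swapped pair**: `u 0` is the
new point at infinity, `u z = v z⁻¹` for `z ≠ 0`, and `v 0 ∈ range v`. -/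
theorem pairImage_subset_swap {X : Type} {u v : ℂ → X} (hc : ∀ z : ℂ, z ≠ 0 → v z = u z⁻¹) :
    pairImage u v ⊆ pairImage v u := by
  intro y hy
  rw [mem_pairImage_iff] at hy ⊢
  rcases hy with ⟨z, rfl⟩ | rfl
  · by_cases hz : z = 0
    · subst hz
      exact Or.inr rfl
    · exact Or.inl ⟨z⁻¹, by rw [hc z⁻¹ (inv_ne_zero hz), inv_inv]⟩
  · exact Or.inl ⟨0, rfl⟩

end CaseALeaf

open CaseALeaf

/-- **L6a (registered helper `helper_caseA_leaf`): case (A) of Gromov compactness applied to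
leaves produces a LEAF through the limit point.**  With the foliation data, the facts F6
(`jSphere_wedgeCount_factorsThroughHomology`) and F4
(`adjunction_embedded_of_somewhereInjective_sphere`) as hypotheses, glued maps `Fs n ~ F₀`,
points `ys n ∈ range (Fs n)` converging to `y`, and reparametrised maps `(Fs (φ k)) ∘ [A k] → F`
with `F` glued to the `JX`-two-chart sphere `(u, v)`: (1) `F ~ F₀` (`[A k] ~ id` and homotopy
classes are closed under limits); (2) `y ∈ range F = pairImage u v` (subsequence of parameters,
joint continuity of evaluation, `helper_gluedRange`); (3) `(u, v)` meets `S_H` once, simply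
(`helper_class_count` at `t = 0`, `helper_countOneStructure`); (4) it is therefore somewhere
injective — in the affine chart, or, after the chart swap `helper_swapGlued`, at the new origin —
and the adjunction fact makes it (resp. the swapped pair) an embedded sphere with a normal
witness, i.e. a leaf, containing `y`. -/
theorem helper_caseA_leaf : ∀ (X : Type) [TopologicalSpace X] [T2Space X]
    [SecondCountableTopology X] [CompactSpace X] [ConnectedSpace X]
    [ChartedSpace (EuclideanSpace ℝ (Fin 4)) X] [IsManifold (𝓡 4) ∞ X] (ωX : MForm (𝓡 4) X ℝ 2)
    (JX : AlmostComplexStructure (𝓡 4) ∞ X) (u₀ v₀ uH vH : ℂ → X)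
    (F₀ : C(ComplexProjectiveSpace 1, X)) (TH TV : X → ℂ) (UH UV : Set X) (δ : ℝ),
    jSphere_wedgeCount_factorsThroughHomology →
    adjunction_embedded_of_somewhereInjective_sphere →
    FoliationData ωX JX u₀ v₀ uH vH F₀ TH TV UH UV δ →
    ∀ (Fs : ℕ → C(ComplexProjectiveSpace 1, X)) (ys : ℕ → X) (y : X) (φ : ℕ → ℕ)
      (u v : ℂ → X) (F : C(ComplexProjectiveSpace 1, X))
      (A : ℕ → ((Fin 2 → ℂ) ≃ₗ[ℂ] (Fin 2 → ℂ))),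
    (∀ n, (Fs n).Homotopic F₀) → (∀ n, ys n ∈ Set.range (Fs n)) → Tendsto ys atTop (𝓝 y) →
    StrictMono φ → TwoChartSphere (fun y => JX y) u v → IsGlued F u v →
    Tendsto (fun k => (Fs (φ k)).comp
      ⟨PlusOneSpherePair.projectiveMap (A k), PlusOneSpherePair.continuous_projectiveMap (A k)⟩)
      atTop (𝓝 F) →
    ∃ u' v' : ℂ → X, IsLeafOf (fun y => JX y) F₀ u' v' ∧ y ∈ pairImage u' v' := by
  intro X _ _ _ _ _ _ _ ωX JX u₀ v₀ uH vH F₀ TH TV UH UV δ hfact hadj D Fs ys y φ u v F A hhom hys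
    hy hφ huv hF hlim
  -- Step 1: `F ~ F₀`
  have hGhom : ∀ k, ((Fs (φ k)).comp ⟨PlusOneSpherePair.projectiveMap (A k),
      PlusOneSpherePair.continuous_projectiveMap (A k)⟩).Homotopic F₀ := fun k => by
    have h := (hhom (φ k)).comp (helper_moebiusHomotopic (A k))
    rwa [ContinuousMap.comp_id] at h
  have hFhom : F.Homotopic F₀ := ContinuousMap.Homotopic.of_tendsto (IN := 𝓡 4) hGhom hlim
  -- Step 2: `y ∈ range F`
  haveI : TopologicalSpace.MetrizableSpace (ComplexProjectiveSpace 1) :=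
    TopologicalSpace.metrizableSpace_of_t3_secondCountable _
  have hysk : ∀ k, ys (φ k) ∈ range ((Fs (φ k)).comp ⟨PlusOneSpherePair.projectiveMap (A k),
      PlusOneSpherePair.continuous_projectiveMap (A k)⟩) := fun k => by
    obtain ⟨q, hq⟩ := hys (φ k)
    exact ⟨PlusOneSpherePair.projectiveMap (A k).symm q, by simpa using hq⟩
  have hyF : y ∈ range F := mem_range_of_tendsto hlim hysk (hy.comp hφ.tendsto_atTop)
  -- Step 3: `y ∈ pairImage u v`
  have hyuv : y ∈ pairImage u v := by
    rw [pairImage_eq, ← helper_gluedRange X u v F huv.compat hF.chart_zero hF.chart_one]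
    exact hyF
  -- Step 4: count one at `t = 0`, structure of the meeting point
  have hδ0 : ‖(0 : ℂ)‖ < δ := by simpa using D.δ_pos
  obtain ⟨hcount, hnot⟩ := helper_class_count X ωX JX u₀ v₀ uH vH F₀ TH TV UH UV δ hfact D u v F
    huv hF hFhom 0 hδ0
  have hT0 : (fun y => TH y - 0) = TH := funext fun y => sub_zero (TH y)
  rw [hT0] at hcount
  have hex : ∃ z : ℂ, ¬ (u z ∈ UH ∧ TH (u z) = 0) := by simpa only [sub_zero] using hnot
  have hcl : IsClosed {y : X | y ∈ UH ∧ TH y = 0} := (D.levelsH 0 hδ0).isClosed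
  rcases helper_countOneStructure X (fun y => JX y) TH UH u v D.coordH.isOpen D.coordH.smooth
      D.coordH.hol hcl huv.smooth_u huv.smooth_v huv.compat huv.hol_u huv.hol_v hex
      ((wedgeCount_eq TH UH u v).symm.trans hcount) with
    ⟨z₀, hz₀, huniq, hv0, hd⟩ | ⟨hnone, hv0, hd⟩
  · -- Step 5, the meeting point is in the affine chart: `(u, v)` is somewhere injective at `z₀`
    refine ⟨u, v, isLeafOf_of_somewhereInjective hadj D huv hF hFhom ⟨z₀, ?_, ?_, ?_⟩, hyuv⟩
    · exact injective_mfderiv_of_deriv_comp_ne_zero D.coordH huv.smooth_u huv.hol_u hz₀.1 hd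
    · intro z hz
      exact huniq z (by rw [hz]; exact hz₀)
    · intro h
      exact hv0 (by rw [h]; exact hz₀)
  · -- Step 5, the meeting point is `v 0`: swap the charts, `(v, u)` is somewhere injective at `0`
    obtain ⟨σ, hσ, h0, h1⟩ := helper_swapGlued X u v F huv.compat hF.chart_zero hF.chart_one
    have hvu : TwoChartSphere (fun y => JX y) v u := twoChartSphere_swap huv
    have hFσ : IsGlued (F.comp σ) v u := ⟨h0, h1⟩
    have hFσhom : (F.comp σ).Homotopic F₀ := by
      have h := (ContinuousMap.Homotopic.refl F).comp hσ
      rw [ContinuousMap.comp_id] at h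
      exact h.trans hFhom
    refine ⟨v, u, isLeafOf_of_somewhereInjective hadj D hvu hFσ hFσhom ⟨0, ?_, ?_, ?_⟩,
      pairImage_subset_swap huv.compat hyuv⟩
    · exact injective_mfderiv_of_deriv_comp_ne_zero D.coordH huv.smooth_v huv.hol_v hv0.1 hd
    · intro w hw
      by_contra hw0
      exact hnone w⁻¹ (by rw [← huv.compat w hw0, hw]; exact hv0)
    · intro h
      exact hnone 0 (by rw [h]; exact hv0)

end Summit.SmoothPoincare4.SmoothPoincare4.Theorems.GromovRecognitionRelEnd.CrossCapLaurent

end
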